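import Mathlib
import Summits.ValiantsHypothesis.ValiantsHypothesis.Theses.ValuativeGCT
import Literature.NumberTheory.DiophantineGeometry.DetStabilizerFrobenius

/-!
# Line `pfaffian-square-address` for crux `ValuativeGCT.CutBites` (stmt-ValiantsHypothesis-12626)

Skeleton (crux-plan, round 1) of the idea card `Cruxes/CutBites/Ideas/pfaffian-square-address.md`
(triage r1: pass ×3).  The crux: for every odd `m ≥ 3` the skew Edmonds-gap space `Λ_m` truncates
strictly somewhere, `finrank T_Λ(δ, λ*) < finrank T_Λ(0, λ*)` for some `δ` and `λ ⊢ mδ`.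

THE LINE (δ = 2).  Blow the `m²` row slots of `A ∈ End(ℂ^{m×m})` up with SYMMETRIC `2 × 2`
matrices `T_j`: `G_T(A) = det_{2m}(∑_j T_j ⊗ X_j(A))` (`X_j(A)` = row `j` of `A` as an `m × m`
matrix) is a form of degree `2m` which is

* invariant under the whole `End`-stabiliser `H` of `det_m` — by Frobenius–Marcus–Moyls every
  `M ∈ H` acts on rows by `X ↦ PXQ` or `X ↦ PXᵀQ` with `det P = det Q = 1`, and
  `det((1⊗P)(∑ T_j ⊗ X_j)(1⊗Q)) = det(∑ T_j ⊗ X_j)`, `∑ T_j ⊗ X_jᵀ = (∑ T_j ⊗ X_j)ᵀ` because the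
  `T_j` are symmetric (stub B `stub_blowupStabInvariant`, fed by stub C `stub_frobeniusSandwich`);
* NOT in the ideal of `L_Λ = {all rows skew}`: on `L_Λ` the `2m × 2m` matrix `∑ T_j ⊗ S_j` is skew,
  `G_T|_{L_Λ} = Pf(∑ T_j ⊗ S_j)²`, and the block-diagonal certificate
  `T = (1, σ_x, σ_z, 1)`, `S = (E₁₂−E₂₁, E₁₃−E₃₁, E₂₃−E₃₂, 0₃ ⊕ J_{m−3})` has determinant
  `det K₃ · det(J_{m−3})² = 4` for every odd `m ≥ 3` (stub A `stub_skewSymBlowupWitness`);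
* hence, `L_Λ` being stable under the left `GL_{m²}`-action and `Hom_{2m} ∩ (H-invariants)` being
  a finite-dimensional rational (so semisimple) `GL_{m²}`-module, some highest-weight vector of
  some weight `λ*`, `λ ⊢ 2m` with `≤ m²` parts, is non-zero somewhere on `L_Λ`
  (stub D `stub_highestWeightWitness`, over the tree's discharged highest-weight facts);
* and a single element of `T(0)` with one non-zero value on `L_Λ` cuts `finrank T(t) < finrank T(0)`
  for every threshold `t ≥ 1` (§1, the cut criterion = Disproof.lean §B, reproduced sorry-free),
  in particular at `t = δ = 2`: `CutBites_of` / `CutBites_proof`.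

Disproof.lean (standing disprover, gen 2) honoured: §C.1 `not_cutBitesAtDeltaOne` /
`trunc_one_eq_trunc_zero_of_odd` (δ odd never works) — this line works at `δ = 2`, the first rung;
§A `cutBites_false_without_three_le` (`3 ≤ m` load-bearing) — used in stub A
(the certificate needs three skew slots `E₁₂, E₁₃, E₂₃`); §B is the composition step. No
`_false_without_` theorem or landed `Negative/` lemma touches a blow-up at even `δ`.

File layout: §0 the crux unbundled (its `let`s as named `def`s, verbatim; `cutBites_iff` is
`Iff.rfl`) · §1 cut criterion (sorry-free) · §2 the blow-up polynomial, its evaluation and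
homogeneity (sorry-free) · §3 the four stub statements as precise `def <Name> : Prop` with the
registered `sorry`d theorems `stub_<name> : <Name>` · §4 the sorry-free glue
`CutBites_of : SkewSymBlowupWitness → BlowupStabInvariant → FrobeniusSandwich → HighestWeightWitness →
(crux statement, unbundled by the `Iff.rfl` lemma `cutBites_iff`)` and the skeleton
`CutBites_proof : Summit.ValiantsHypothesis.ValiantsHypothesis.Theses.ValuativeGCT.CutBites :=
cutBites_iff.mpr (CutBites_of stub_A stub_B stub_C stub_D)` — the one theorem concluding the route decl
BY NAME (D-0027 §3.3).
-/

set_option linter.dupNamespace false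

namespace Summit.ValiantsHypothesis.ValiantsHypothesis.Cruxes.CutBites.PfaffianSquareAddress

open Literature.NumberTheory.DiophantineGeometry Literature.Computability.AlgebraicComplexity
open MvPolynomial
open scoped BigOperators Matrix Kronecker

noncomputable section

/-! ## §0 The crux unbundled (verbatim the `let`s of `ValuativeGCT.CutBites`; cf. Disproof.lean §0) -/

/-- Coordinates `A (j, i)` of `End(ℂ^{m×m})`: row `j`, column `i`. -/
abbrev Idx (m : ℕ) : Type := MatIdx m × MatIdx m

/-- The skew-symmetric Edmonds-gap space `Λ_m` — verbatim the crux's `U`. -/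
def skewU (m : ℕ) : Submodule ℂ (MatIdx m → ℂ) :=
  Submodule.span ℂ {u : MatIdx m → ℂ | ∀ a b : Fin m, u (toLex (a, b)) = -u (toLex (b, a))}

/-- `L_U = {A : every row of A lies in U}`. -/
def locus (m : ℕ) (U : Submodule ℂ (MatIdx m → ℂ)) : Set (Idx m → ℂ) :=
  {p : Idx m → ℂ | ∀ j : MatIdx m, (fun i => p (j, i)) ∈ U}

/-- `P_U`, the vanishing ideal of `L_U`. -/
def vanI (m : ℕ) (U : Submodule ℂ (MatIdx m → ℂ)) : Ideal (MvPolynomial (Idx m) ℂ) :=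
  MvPolynomial.vanishingIdeal ℂ (locus m U)

/-- Right invariance under the `End`-stabiliser `H` of `det_m` (`A ↦ AM`) — the crux's third factor. -/
def stabInv (m : ℕ) : Submodule ℂ (MvPolynomial (Idx m) ℂ) :=
  ⨅ (M : Matrix (MatIdx m) (MatIdx m) ℂ)
    (_ : linSubst (MatIdx m) ℂ M (detFormLex ℂ m) = detFormLex ℂ m),
    LinearMap.ker ((MvPolynomial.aeval (R := ℂ) fun p : Idx m =>
      ∑ l : MatIdx m, M l p.2 • MvPolynomial.X (p.1, l)).toLinearMap
      - LinearMap.id (R := ℂ) (M := MvPolynomial (Idx m) ℂ))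

/-- Left `B`-semi-invariance of weight `χ` (`G ↦ G(g⁻¹A)`, upper-triangular `g`) — the crux's
fourth factor. -/
def hwSp (m : ℕ) (χ : Weight (MatIdx m)) : Submodule ℂ (MvPolynomial (Idx m) ℂ) :=
  ⨅ (g : Matrix.GeneralLinearGroup (MatIdx m) ℂ) (_ : IsUpperTriangular g),
    LinearMap.ker ((MvPolynomial.aeval (R := ℂ) fun p : Idx m =>
      ∑ l : MatIdx m, ((g⁻¹ : Matrix.GeneralLinearGroup (MatIdx m) ℂ) :
        Matrix (MatIdx m) (MatIdx m) ℂ) p.1 l • MvPolynomial.X (l, p.2)).toLinearMap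
      - weightChar χ g • LinearMap.id (R := ℂ) (M := MvPolynomial (Idx m) ℂ))

/-- The truncation in degree `D`, for a row space `U`, weight `χ`, threshold `t`. -/
def truncU (m D : ℕ) (U : Submodule ℂ (MatIdx m → ℂ)) (χ : Weight (MatIdx m)) (t : ℕ) :
    Submodule ℂ (MvPolynomial (Idx m) ℂ) :=
  MvPolynomial.homogeneousSubmodule (Idx m) ℂ D ⊓ ((vanI m U) ^ t).restrictScalars ℂ
    ⊓ stabInv m ⊓ hwSp m χ

/-- The crux's `T t` at `(m, δ, λ)`. -/
def trunc (m δ : ℕ) (lam : Nat.Partition (m * δ)) (t : ℕ) : Submodule ℂ (MvPolynomial (Idx m) ℂ) :=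
  truncU m (m * δ) (skewU m) (Weight.dualOfPartition (m * m) lam).toMatIdx t

/-- The crux, unbundled — definitionally (`Iff.rfl`), so the `def`s above ARE the crux's `let`s. -/
theorem cutBites_iff :
    Theses.ValuativeGCT.CutBites ↔
      ∀ m : ℕ, Odd m → 3 ≤ m → ∃ (δ : ℕ) (lam : Nat.Partition (m * δ)),
        lam.parts.card ≤ m * m ∧
          Module.finrank ℂ ↥(trunc m δ lam δ) < Module.finrank ℂ ↥(trunc m δ lam 0) :=
  Iff.rfl

/-! ## §1 The cut criterion (Disproof.lean §B, gen 2, reproduced so that the line is self-contained) -/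

section Criterion

variable {m D : ℕ} {U : Submodule ℂ (MatIdx m → ℂ)} {χ : Weight (MatIdx m)}

/-- `T(t) ≤ T(0)`. -/
theorem truncU_le_zero (t : ℕ) : truncU m D U χ t ≤ truncU m D U χ 0 := by
  unfold truncU
  exact inf_le_inf_right _ (inf_le_inf_right _ (inf_le_inf_left _
    (Submodule.restrictScalars_mono ℂ (Ideal.pow_le_pow_right (Nat.zero_le t)))))

/-- `T(0)` is cut out by degree and the two invariance conditions only (`P^0 = ⊤`). -/
theorem truncU_zero :
    truncU m D U χ 0 = MvPolynomial.homogeneousSubmodule (Idx m) ℂ D ⊓ stabInv m ⊓ hwSp m χ := by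
  unfold truncU
  rw [pow_zero, Ideal.one_eq_top, Submodule.restrictScalars_top, inf_top_eq]

/-- Every `T(t)` is finite-dimensional (it sits in one graded piece). -/
instance finiteDimensional_truncU (t : ℕ) : FiniteDimensional ℂ ↥(truncU m D U χ t) := by
  have : Module.Finite ℂ ↥(MvPolynomial.homogeneousSubmodule (Idx m) ℂ D) :=
    Module.Finite.iff_fg.mpr (MvPolynomial.homogeneousSubmodule_fg (Idx m) ℂ D)
  have hle : truncU m D U χ t ≤ MvPolynomial.homogeneousSubmodule (Idx m) ℂ D := by
    unfold truncU
    exact inf_le_left.trans (inf_le_left.trans inf_le_left)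
  exact Submodule.finiteDimensional_of_le hle

/-- For `t ≥ 1`, elements of `T(t)` vanish on `L_U`. -/
theorem eval_eq_zero_of_mem_truncU {t : ℕ} (ht : 0 < t) {G : MvPolynomial (Idx m) ℂ}
    (hG : G ∈ truncU m D U χ t) {p : Idx m → ℂ} (hp : p ∈ locus m U) :
    MvPolynomial.eval p G = 0 := by
  have h : G ∈ (vanI m U).restrictScalars ℂ := by
    unfold truncU at hG
    refine Submodule.restrictScalars_mono ℂ ?_ (inf_le_left (b := stabInv m)
      (inf_le_left (b := hwSp m χ) hG) |> inf_le_right (a := homogeneousSubmodule (Idx m) ℂ D))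
    exact (Ideal.pow_le_pow_right ht).trans_eq (pow_one _)
  rw [Submodule.restrictScalars_mem, vanI, mem_vanishingIdeal_iff] at h
  simpa [MvPolynomial.coe_aeval_eq_eval] using h p hp

/-- **Cut criterion.** An element of `T(0)` with one non-zero value on `L_U` forces
`finrank T(t) < finrank T(0)` for every threshold `t ≥ 1`. -/
theorem finrank_lt_of_eval_ne_zero {t : ℕ} (ht : 0 < t) {G : MvPolynomial (Idx m) ℂ}
    (hG : G ∈ truncU m D U χ 0) {p : Idx m → ℂ} (hp : p ∈ locus m U)
    (hGp : MvPolynomial.eval p G ≠ 0) :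
    Module.finrank ℂ ↥(truncU m D U χ t) < Module.finrank ℂ ↥(truncU m D U χ 0) := by
  refine Submodule.finrank_lt_finrank_of_lt (lt_of_le_of_ne (truncU_le_zero t) fun h => hGp ?_)
  have hG' : G ∈ truncU m D U χ t := by rw [h]; exact hG
  exact eval_eq_zero_of_mem_truncU ht hG' hp

end Criterion

/-- **What the line supplies to the crux, per `m`** (Disproof.lean §B `cutBites_of_witness`, un-curried so
that no auxiliary theorem of this file concludes the crux decl itself): one `δ ≥ 1`, one `λ`, one
`G ∈ T(0)` and one point of `L_Λ` where `G ≠ 0` give the crux's `∃ δ λ, … ∧ finrank T(δ) < finrank T(0)`. -/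
theorem exists_cut_of_witness {m δ : ℕ} (hδ : 0 < δ) (lam : Nat.Partition (m * δ))
    (hcard : lam.parts.card ≤ m * m) {G : MvPolynomial (Idx m) ℂ} (hG : G ∈ trunc m δ lam 0)
    {p : Idx m → ℂ} (hp : p ∈ locus m (skewU m)) (hGp : MvPolynomial.eval p G ≠ 0) :
    ∃ (δ : ℕ) (lam : Nat.Partition (m * δ)), lam.parts.card ≤ m * m ∧
      Module.finrank ℂ ↥(trunc m δ lam δ) < Module.finrank ℂ ↥(trunc m δ lam 0) :=
  ⟨δ, lam, hcard, finrank_lt_of_eval_ne_zero hδ hG hp hGp⟩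

/-! ## §2 The symmetric `2 × 2` blow-up `G_T(A) = det_{2m}(∑_j T_j ⊗ X_j(A))` -/

/-- Row `j` of the point `p ∈ End(ℂ^{m×m})` as an `m × m` matrix, `(a, b) ↦ p (j, (a, b))`. -/
def rowMat {m : ℕ} (p : Idx m → ℂ) (j : MatIdx m) : Matrix (Fin m) (Fin m) ℂ :=
  Matrix.of fun a b => p (j, toLex (a, b))

/-- Row `j` of the generic point: the `m × m` matrix of variables `X (j, (a, b))`. -/
def rowMatX (m : ℕ) (j : MatIdx m) : Matrix (Fin m) (Fin m) (MvPolynomial (Idx m) ℂ) :=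
  Matrix.of fun a b => X (j, toLex (a, b))

/-- The `2m × 2m` blow-up matrix `∑_j T_j ⊗ X_j` over the polynomial ring. -/
def blowupMat (m : ℕ) (T : MatIdx m → Matrix (Fin 2) (Fin 2) ℂ) :
    Matrix (Fin 2 × Fin m) (Fin 2 × Fin m) (MvPolynomial (Idx m) ℂ) :=
  ∑ j : MatIdx m, (T j).map C ⊗ₖ rowMatX m j

/-- The blow-up polynomial `G_T = det(∑_j T_j ⊗ X_j)`, a form of degree `2m` on `End(ℂ^{m×m})`. -/
def blowup (m : ℕ) (T : MatIdx m → Matrix (Fin 2) (Fin 2) ℂ) : MvPolynomial (Idx m) ℂ :=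
  (blowupMat m T).det

/-- Evaluating the blow-up at a point `p`: `G_T(p) = det(∑_j T_j ⊗ rowMat p j)`. -/
theorem eval_blowup {m : ℕ} (T : MatIdx m → Matrix (Fin 2) (Fin 2) ℂ) (p : Idx m → ℂ) :
    MvPolynomial.eval p (blowup m T) = (∑ j : MatIdx m, T j ⊗ₖ rowMat p j).det := by
  rw [blowup, RingHom.map_det, blowupMat, map_sum]
  congr 1
  refine Finset.sum_congr rfl fun j _ => ?_
  rw [RingHom.mapMatrix_apply, Matrix.kroneckerMap_map]
  ext ⟨a, c⟩ ⟨b, d⟩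
  simp [Matrix.kroneckerMap_apply, rowMatX, rowMat]

/-- Every entry of the blow-up matrix is a linear form. -/
theorem blowupMat_isHomogeneous {m : ℕ} (T : MatIdx m → Matrix (Fin 2) (Fin 2) ℂ)
    (i k : Fin 2 × Fin m) : (blowupMat m T i k).IsHomogeneous 1 := by
  rw [blowupMat, Matrix.sum_apply]
  refine IsHomogeneous.sum _ _ _ fun j _ => ?_
  rw [Matrix.kroneckerMap_apply, Matrix.map_apply, rowMatX, Matrix.of_apply]
  simpa using (isHomogeneous_C _ (T j i.1 k.1)).mul (isHomogeneous_X ℂ (j, toLex (i.2, k.2)))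

/-- The blow-up is homogeneous of degree `m * 2` (= `mδ` at `δ = 2`). -/
theorem blowup_isHomogeneous {m : ℕ} (T : MatIdx m → Matrix (Fin 2) (Fin 2) ℂ) :
    (blowup m T).IsHomogeneous (m * 2) := by
  rw [blowup, Matrix.det_apply]
  refine IsHomogeneous.sum _ _ _ fun π _ => ?_
  have hprod := IsHomogeneous.prod (φ := fun i : Fin 2 × Fin m => blowupMat m T (π i) i)
    Finset.univ (fun _ => 1) fun i _ => blowupMat_isHomogeneous T (π i) i
  rw [Units.smul_def, zsmul_eq_mul, ← map_intCast (C : ℂ →+* MvPolynomial (Idx m) ℂ)]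
  simp only [Finset.sum_const, smul_eq_mul, mul_one, Finset.card_univ, Fintype.card_prod,
    Fintype.card_fin] at hprod
  have h2 : m * 2 = 0 + 2 * m := by ring
  rw [h2]
  exact (isHomogeneous_C _ _).mul hprod

/-- Hence `G_T` lies in the degree-`2m` piece. -/
theorem blowup_mem_homogeneousSubmodule {m : ℕ} (T : MatIdx m → Matrix (Fin 2) (Fin 2) ℂ) :
    blowup m T ∈ MvPolynomial.homogeneousSubmodule (Idx m) ℂ (m * 2) :=
  (MvPolynomial.mem_homogeneousSubmodule _ _).mpr (blowup_isHomogeneous T)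

/-! ## §3 The registered stubs

Shape (D-0027 §3.3, within what a seat may write — `@[stub]` tags are gate-reserved): each stub
statement is a precise `Prop` (`def <Name> : Prop`, docstring = statement, plan, size, sources); the
REGISTERED stub is the sorried `theorem stub_<name> : <Name>`; the sorry-free glue
`CutBites_of : SkewSymBlowupWitness → BlowupStabInvariant → FrobeniusSandwich → HighestWeightWitness → (crux, unbundled)`
ends in the crux's own statement through `cutBites_iff` (`Iff.rfl`), and EXACTLY ONE theorem of the
file, the skeleton `CutBites_proof : ValuativeGCT.CutBites := cutBites_iff.mpr (CutBites_of stub_… …)`,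
concludes the route decl BY NAME (the `#h21_check_skeleton` audit takes the first such theorem; keeping it
unique and hypothesis-free makes the verdict deterministic and `closed` honest). -/

/-- **Stub A — the symmetric skew blow-up witness** (card: First lemma `SkewSymBlowupNonsingular`;
size M).  For every odd `m ≥ 3` there are SYMMETRIC `2 × 2` matrices `T_j` (one per row slot
`j : MatIdx m`, all but four zero) and a point `p ∈ L_Λ` (all `m²` rows skew) with
`det(∑_j T_j ⊗ rowMat p j) ≠ 0`.  Certificate, uniform in odd `m`: on four slots `j₁..j₄` put
`T = (1, σ_x, σ_z, 1)` and rows `S = (E₁₂−E₂₁, E₁₃−E₃₁, E₂₃−E₃₂, 0₃ ⊕ J_{m−3})` (`J` the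
standard symplectic form, `m − 3` even), all other rows `0`; grouping the `m`-indices
`{1,2,3} | {4..m}` the matrix is block-diagonal `K₃ ⊕ (1₂ ⊗ J_{m−3})`, so
`det = det K₃ · det(J_{m−3})² = 4 · 1` (exact check `m = 3,5,…,11`: toy/blowup_witness.py here, `≤ 15`
in the card, three triage seats).  Why plausible: a finite identity per `m` with a uniform block proof
(`Matrix.det_fromBlocks_zero₂₁` / `Matrix.det_blockDiagonal`, `Matrix.det_kronecker`, a
`Fin 3 ⊕ Fin (m-3)` reindexing `Matrix.det_reindex_self`); uses `3 ≤ m` (Disproof §A: load-bearing).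
On `L_Λ` the matrix is skew of even size, so the value is a Pfaffian square (`= (±2)²`). -/
def SkewSymBlowupWitness : Prop :=
  ∀ m : ℕ, Odd m → 3 ≤ m →
    ∃ (T : MatIdx m → Matrix (Fin 2) (Fin 2) ℂ) (p : Idx m → ℂ),
      (∀ j, (T j).IsSymm) ∧ p ∈ locus m (skewU m) ∧
        (∑ j : MatIdx m, T j ⊗ₖ rowMat p j).det ≠ 0

/-- **Stub C — Frobenius' determinant-preserver theorem, Marcus–Moyls form** (VERBATIM the tree's
named fact `Literature.NumberTheory.DiophantineGeometry.frobenius_detPreserver_unimodular_sandwich`,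
cite item wi-26984: MarcusMoyls1959 Thm 2 with Lemma 7; Landsberg2017 Thm 6.6.1.1; size L,
est. 1–1.5 kLoC — or the line closes CONDITIONALLY on the named fact).  Every linear `M` (not
assumed invertible) whose substitution fixes `det_m` is a unimodular sandwich `X ↦ PXQ` or
`X ↦ PXᵀQ`, `det P = det Q = 1`, on coordinate vectors `x ↦ Mᵀ *ᵥ x`.  Discharge plan = the merged
Frobenius line (cards segre-ruling-stabiliser ≈ pencil-degree-frobenius): `rank X = max_Y deg_t
det(tX + Y)` ⇒ det-preservers do not decrease rank ⇒ injective (cheaper: `M* cof(MX) = cof X`,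
triage r1-3) ⇒ rank-one preservers ⇒ Marcus–Moyls ⇒ unimodular normalisation by an `m`-th root of
`det Q`.  SHARED by every blow-up / sandwich / Plücker line of this crux (triage r1-2). -/
def FrobeniusSandwich : Prop :=
  ∀ (m : ℕ) (M : Matrix (MatIdx m) (MatIdx m) ℂ),
    linSubst (MatIdx m) ℂ M (detFormLex ℂ m) = detFormLex ℂ m →
    ∃ P Q : Matrix (Fin m) (Fin m) ℂ, P.det = 1 ∧ Q.det = 1 ∧
      ((∀ x : MatIdx m → ℂ,
          (Matrix.of fun a b => (Mᵀ *ᵥ x) (toLex (a, b))) =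
            P * (Matrix.of fun a b => x (toLex (a, b))) * Q) ∨
       (∀ x : MatIdx m → ℂ,
          (Matrix.of fun a b => (Mᵀ *ᵥ x) (toLex (a, b))) =
            P * (Matrix.of fun a b => x (toLex (a, b)))ᵀ * Q))

/-- Stub C is, verbatim, the named fact (so any discharge of wi-26984 closes it by `id`). -/
example : FrobeniusSandwich ↔ frobenius_detPreserver_unimodular_sandwich := Iff.rfl

/-- **Stub B — symmetric blow-ups are `Stab(det_m)`-invariant, given Frobenius** (card: Lever,
"invariant under `X ↦ PXQ` AND under transpose on the nose"; size M).  If every `M` in the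
`End`-stabiliser of `det_m` acts on rows as a unimodular sandwich (Stub C), then for symmetric `T_j`
the blow-up `G_T` is fixed by the crux's substitution `X(j,i) ↦ ∑_l M_{li} X(j,l)` (row-wise
`linSubst M`, i.e. `A ↦ AM`, each row `x_j ↦ Mᵀ *ᵥ x_j` — exactly the shape in which Stub C is
stated): `∑ T_j ⊗ (P X_j Q) = (1 ⊗ P)(∑ T_j ⊗ X_j)(1 ⊗ Q)` (`Matrix.mul_kronecker_mul`),
`det(1 ⊗ P) = det P ^ 2 = 1` (`Matrix.det_kronecker`); transpose case `∑ T_j ⊗ X_jᵀ = ∑ T_jᵀ ⊗ X_jᵀ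
= (∑ T_j ⊗ X_j)ᵀ` (`Matrix.kroneckerMap_transpose`, `T_jᵀ = T_j`), `Matrix.det_transpose`.  The
sandwich identity over `ℂ` extends to rows with polynomial entries by linearity in `x` (or prove the
polynomial identity through `MvPolynomial.funext` + `eval_blowup`); membership plumbing as in
Disproof §D (`mem_stabInv_iff`, `aeval_rowAct_rename`).  Why it might fail: only by a convention
slip on the side of the action; the abstract stabiliser cannot be avoided for blow-ups (triage r1-3:
only the adjugate discriminant `W3` has a Frobenius-free invariance proof). -/
def BlowupStabInvariant : Prop :=
  FrobeniusSandwich →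
    ∀ (m : ℕ) (T : MatIdx m → Matrix (Fin 2) (Fin 2) ℂ), (∀ j, (T j).IsSymm) →
      blowup m T ∈ stabInv m

/-- **Stub D — highest-weight extraction** (card: "hw theorems (discharged)"; size L, plumbing over
proved tree facts).  Pure representation theory of the LEFT action `G ↦ G(g⁻¹A)` of
`GL_{m²} = GL(MatIdx m)` on `ℂ[End(ℂ^{m×m})]`: if a degree-`D` form `G`, invariant under the
`End`-stabiliser of `det_m` (right action, commuting with the left one), does not vanish identically
on `L_U = {all rows in U}` (a left-`GL_{m²}`-stable set, for ANY row space `U`), then for some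
partition `λ ⊢ D` with at most `m²` parts some highest-weight vector of weight
`λ* = (dualOfPartition (m*m) λ).toMatIdx` in `Hom_D ∩ (H-invariants)` — an element of
`T_U(D, λ*, 0)` (`truncU_zero`) — does not vanish identically on `L_U` either.  Proof plan:
`V := Hom_D ⊓ stabInv` is a finite-dimensional rational `GL_{m²}`-module (matrix coefficients are
polynomials in `g⁻¹`), hence semisimple (`isSemisimpleRepresentation_of_isRationalRep_holds`,
GLPolynomialRepSemisimpleProofs); `N := V ∩ P_U` is a proper subrepresentation (`G ∉ N`), so a
complement / simple summand `N' ≠ 0` meets `N` in `0` and carries a highest-weight vector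
(`exists_hasHighestWeight_of_finiteDimensional_holds`, GLHighestWeightExistsUniqueProofs,
`IsAlgClosed ℂ`); its weight is minus a row-content vector (torus on monomials), dominant
(`isDominant_of_hasHighestWeight_holds`, GLHighestWeightDominanceProofs), hence `λ*`
(`Weight.existsUnique_eq_ofPartition_holds`, GLHighestWeightFacts; same bookkeeping as
`exists_eq_toMatIdx_of_hasHighestWeight_detOrbitRep`, SchurWeylPlethysmCoordRepWeightsProofs); the
model of the left action is `formsRep` (ChowPullback) / `linSubstRep` composed with the block matrix
of `(g⁻¹)ᵀ`; `hwSp` membership as in Disproof §D `mem_hwSp_iff`.  Why it might fail: only by a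
convention slip (Borel, `g` vs `g⁻¹`, order of `MatIdx`) — the conventions are the route's own,
re-derived by the three triage seats (hw vectors = polynomials in bottom-justified row minors,
weight `(0,…,0,−λ_ℓ,…,−λ₁)`) and certified by Disproof §D `detRow_pow_mem_trunc_zero`. -/
def HighestWeightWitness : Prop :=
  ∀ (m D : ℕ) (U : Submodule ℂ (MatIdx m → ℂ)) (G : MvPolynomial (Idx m) ℂ),
    G ∈ MvPolynomial.homogeneousSubmodule (Idx m) ℂ D ⊓ stabInv m →
    (∃ p ∈ locus m U, MvPolynomial.eval p G ≠ 0) →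
      ∃ lam : Nat.Partition D, lam.parts.card ≤ m * m ∧
        ∃ G' ∈ truncU m D U (Weight.dualOfPartition (m * m) lam).toMatIdx 0,
          ∃ p ∈ locus m U, MvPolynomial.eval p G' ≠ 0

/-- Registered stub A: the `sorry` of `SkewSymBlowupWitness` (size M). -/
theorem stub_skewSymBlowupWitness : SkewSymBlowupWitness := by
  sorry

/-- Registered stub B: the `sorry` of `BlowupStabInvariant` (size M). -/
theorem stub_blowupStabInvariant : BlowupStabInvariant := by
  sorry

/-- Registered stub C: the `sorry` of `FrobeniusSandwich` (size L; closes by `id` from any discharge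
of the named fact `frobenius_detPreserver_unimodular_sandwich`). -/
theorem stub_frobeniusSandwich : FrobeniusSandwich := by
  sorry

/-- Registered stub D: the `sorry` of `HighestWeightWitness` (size L). -/
theorem stub_highestWeightWitness : HighestWeightWitness := by
  sorry

/-! ## §4 Composition (sorry-free glue `CutBites_of`; the skeleton `CutBites_proof` concludes the route decl by name) -/

/-- **The line closes the crux.**  Stub A (witness) → stub B (invariance from Frobenius) →
stub C (Frobenius) → stub D (highest-weight extraction) → the crux's statement (unbundled by
`cutBites_iff`, an `Iff.rfl`), at `δ = 2` through the cut criterion §1.  Sorry-free. -/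
theorem CutBites_of (hA : SkewSymBlowupWitness) (hB : BlowupStabInvariant) (hC : FrobeniusSandwich)
    (hD : HighestWeightWitness) :
    ∀ m : ℕ, Odd m → 3 ≤ m → ∃ (δ : ℕ) (lam : Nat.Partition (m * δ)),
      lam.parts.card ≤ m * m ∧
        Module.finrank ℂ ↥(trunc m δ lam δ) < Module.finrank ℂ ↥(trunc m δ lam 0) := by
  intro m hm h3
  obtain ⟨T, p, hT, hp, hdet⟩ := hA m hm h3
  have hG : blowup m T ∈ MvPolynomial.homogeneousSubmodule (Idx m) ℂ (m * 2) ⊓ stabInv m :=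
    Submodule.mem_inf.mpr ⟨blowup_mem_homogeneousSubmodule T, hB hC m T hT⟩
  have hev : ∃ p ∈ locus m (skewU m), MvPolynomial.eval p (blowup m T) ≠ 0 :=
    ⟨p, hp, by rwa [eval_blowup]⟩
  obtain ⟨lam, hcard, G', hG', q, hq, hGq⟩ := hD m (m * 2) (skewU m) (blowup m T) hG hev
  exact exists_cut_of_witness two_pos lam hcard hG' hq hGq

/-- **The skeleton** (D-0027 §3.3): `ValuativeGCT.CutBites` BY NAME, modulo exactly the four registered
stubs — `cutBites_iff.mpr (CutBites_of stub_A stub_B stub_C stub_D)`. -/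
theorem CutBites_proof : Summit.ValiantsHypothesis.ValiantsHypothesis.Theses.ValuativeGCT.CutBites :=
  cutBites_iff.mpr (CutBites_of stub_skewSymBlowupWitness stub_blowupStabInvariant stub_frobeniusSandwich
    stub_highestWeightWitness)

end

end Summit.ValiantsHypothesis.ValiantsHypothesis.Cruxes.CutBites.PfaffianSquareAddress
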